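import Summits.ValiantsHypothesis.ValiantsHypothesis.Theorems.GrenetZeonDualUnipotentThreeHalvesLongMassNilSpaceJacobsonCore

/-!
# `GrenetZeon.DualUnipotentThreeHalves` (stmt-ValiantsHypothesis-24318), line `slow_core`, stub (c) `SlowCore.LongMassSlowLawInv`:
# JACOBSON'S THEOREM — a WEAKLY CLOSED nil space is simultaneously strictly triangularisable (the JORDAN / γ-closed row, `c = 2`)

The Engel row (✓ `NilSpaceEngel.exists_unit_conj_strictUpper_of_lieClosed`) prices pencils whose value space is a LIE-closed nil space.
Jacobson's theorem on weakly closed nil sets (N. Jacobson, *Lie Algebras* (1962), Ch. II §2, Theorem 1) is the common generalisation of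
Engel's theorem (`γ = −1`), of Wedderburn's theorem on nil algebras (`γ = 0`) and of the JORDAN case (`γ = +1`): a set of nilpotent linear
transformations of a finite-dimensional space such that every pair `A, B` in it has a scalar `γ(A,B)` with `AB + γ(A,B)·BA` again in the set
generates a nilpotent associative algebra, i.e. is simultaneously strictly triangularisable.  Proved here for subspaces `V ≤ M_b(ℂ)` — the
shape in which the (c)-menu consumes value spaces — from the engines PUSH / CORE of ✓ `…LongMassNilSpaceJacobsonCore` (no Lie theory).

* §4 ★★★ `exists_unit_conj_strictUpper_of_weaklyClosed` — JACOBSON: a weakly closed nil space `V ≤ M_b(ℂ)` is strictly upper triangular in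
  one constant basis.  Proof: take a simultaneously triangularisable subspace `S₀ ≤ V` of maximal dimension with unit `P₀`; conjugate by `P₀`
  (`exists_conjEquiv`); then `W₀ = P₀S₀P₀⁻¹` contains every strictly upper member of `W = P₀VP₀⁻¹` (maximality); if `W ⊄ 𝔫`, PUSH gives
  `Y ∈ W ∖ 𝔫` normalising `W₀` and CORE triangularises `W₀ + ℂY`, of larger dimension — contradiction.  Corollaries: ★ `…_of_jordanClosed`
  (`AB + BA ∈ V`), `…_of_smulClosed` (one fixed `γ`); the Engel case `γ = −1` is ✓ `NilSpaceEngel.exists_unit_conj_strictUpper_of_lieClosed`.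
* §5 ★★ THE JACOBSON ROW `relCert_of_valueSpace_weaklyClosed` / `relCert_of_valueSpace_jordanClosed` — an affine pencil whose values lie in a
  weakly closed (resp. Jordan-closed) nil space has `RelCert n m N (2·(⌊√n⌋·m))`, (c)'s conclusion with `c = 2`, `n₀ = 0`
  (✓ `TriangularRow.relCert_of_valueSpace_triangularisable_two`); `longMass_on_weaklyClosed_locus` in the binder shape of the stub.
  VIOLATOR PORTRAIT (by name): the value space `V` of a (c)-violator is not weakly closed for ANY choice of scalars — for some `A, B ∈ V` the
  whole affine line `AB + γ·BA`, `γ ∈ ℂ`, misses `V`; in particular `V` is neither Lie-, nor Jordan-, nor product-closed.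

HONEST FRAMING.  Calibration row (`--supports stmt-ValiantsHypothesis-24318`), a classical structural law; NOT progress on the research stub (c)
`SlowCore.LongMassSlowLawInv` (an irreducible constituent of size `b ≥ 2` is never triangularisable); closes no stub; S3, 24318, 8062 and
`VP ≠ VNP` are NOT proved.  Def-free, no named-fact hypotheses, no sorry.
[cite: Jacobson1962LieAlgebras, Ch. II §2 Thm. 1]
-/

set_option linter.dupNamespace false
set_option autoImplicit false

noncomputable section

namespace Summit.ValiantsHypothesis.ValiantsHypothesis.Theorems.GrenetZeon.NilSpaceJacobson

open Matrix
open scoped BigOperators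
open Summit.ValiantsHypothesis.ValiantsHypothesis.Cruxes.TwoDimCoefficients.DimTwoCases (AffMat IsAffine)
open Summit.ValiantsHypothesis.ValiantsHypothesis.Theorems.GrenetZeon.SlowCore (RelCert)
open Summit.ValiantsHypothesis.ValiantsHypothesis.Theorems.GrenetZeon.TriangularRow (relCert_of_valueSpace_triangularisable_two)
open Summit.ValiantsHypothesis.ValiantsHypothesis.Theorems.GrenetZeon.NilSpaceEngel

variable {b : ℕ}

/-! ## §4 JACOBSON'S THEOREM for weakly closed nil subspaces of `M_b(ℂ)` -/

/-- Conjugation by a unit as a linear equivalence of `M_b(ℂ)`. -/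
theorem exists_conjEquiv (P : (Matrix (Fin b) (Fin b) ℂ)ˣ) :
    ∃ e : Matrix (Fin b) (Fin b) ℂ ≃ₗ[ℂ] Matrix (Fin b) (Fin b) ℂ,
      ∀ X, e X = (P : Matrix (Fin b) (Fin b) ℂ) * X * (↑P⁻¹ : Matrix (Fin b) (Fin b) ℂ) := by
  set p : Matrix (Fin b) (Fin b) ℂ := (P : Matrix (Fin b) (Fin b) ℂ) with hp
  set q : Matrix (Fin b) (Fin b) ℂ := (↑P⁻¹ : Matrix (Fin b) (Fin b) ℂ) with hq
  have hpq : p * q = 1 := by rw [hp, hq, Units.mul_inv]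
  have hqp : q * p = 1 := by rw [hp, hq, Units.inv_mul]
  refine ⟨{ toFun := fun X => p * X * q
            invFun := fun X => q * X * p
            map_add' := fun X X' => by simp only [Matrix.mul_add, Matrix.add_mul]
            map_smul' := fun c X => by simp only [Matrix.mul_smul, Matrix.smul_mul, RingHom.id_apply]
            left_inv := fun X => by
              show q * (p * X * q) * p = X
              calc q * (p * X * q) * p = (q * p) * X * (q * p) := by simp only [Matrix.mul_assoc]
                _ = X := by rw [hqp, Matrix.one_mul, Matrix.mul_one]
            right_inv := fun X => by
              show p * (q * X * p) * q = X
              calc p * (q * X * p) * q = (p * q) * X * (p * q) := by simp only [Matrix.mul_assoc]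
                _ = X := by rw [hpq, Matrix.one_mul, Matrix.mul_one] }, fun X => rfl⟩

/-- ★★★ **JACOBSON'S THEOREM (weakly closed nil spaces are simultaneously strictly triangularisable).**  If `V ≤ M_b(ℂ)` consists of
nilpotent matrices and is WEAKLY CLOSED — for all `A, B ∈ V` there is a scalar `γ` with `AB + γ·BA ∈ V` — then one unit `P` makes every
`P A P⁻¹`, `A ∈ V`, strictly upper triangular.  (Engel: `γ = −1`; nil algebras: `γ = 0`; Jordan-closed nil spaces: `γ = 1`.)
[cite: Jacobson1962LieAlgebras, Ch. II §2 Thm. 1] -/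
theorem exists_unit_conj_strictUpper_of_weaklyClosed (V : Submodule ℂ (Matrix (Fin b) (Fin b) ℂ))
    (hnil : ∀ A ∈ V, IsNilpotent A) (hwc : ∀ A ∈ V, ∀ B ∈ V, ∃ γ : ℂ, A * B + γ • (B * A) ∈ V) :
    ∃ P : (Matrix (Fin b) (Fin b) ℂ)ˣ, ∀ A ∈ V, ∀ i j : Fin b, j ≤ i →
      ((P : Matrix (Fin b) (Fin b) ℂ) * A * (↑P⁻¹ : Matrix (Fin b) (Fin b) ℂ)) i j = 0 := by
  classical
  -- `Tri S`: the subspace `S` is simultaneously strictly upper triangularisable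
  let Tri : Submodule ℂ (Matrix (Fin b) (Fin b) ℂ) → Prop := fun S =>
    ∃ P : (Matrix (Fin b) (Fin b) ℂ)ˣ, ∀ A ∈ S, ∀ i j : Fin b, j ≤ i →
      ((P : Matrix (Fin b) (Fin b) ℂ) * A * (↑P⁻¹ : Matrix (Fin b) (Fin b) ℂ)) i j = 0
  -- a triangularisable subspace of `V` of maximal dimension
  let Q : ℕ → Prop := fun d => ∃ S ≤ V, Tri S ∧ Module.finrank ℂ S = d
  have hQ0 : Q 0 := ⟨⊥, bot_le, ⟨1, fun A hA i j _ => by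
    rw [(Submodule.mem_bot ℂ).mp hA, Matrix.mul_zero, Matrix.zero_mul, Matrix.zero_apply]⟩, finrank_bot ℂ _⟩
  set d₀ := Nat.findGreatest Q (Module.finrank ℂ V) with hd₀
  obtain ⟨S₀, hS₀V, ⟨P₀, hP₀⟩, hS₀d⟩ : Q d₀ := Nat.findGreatest_spec (P := Q) (Nat.zero_le _) hQ0
  have hmax : ∀ S ≤ V, Tri S → Module.finrank ℂ S ≤ d₀ := fun S hSV hS =>
    hd₀ ▸ Nat.le_findGreatest (P := Q) (Submodule.finrank_mono hSV) ⟨S, hSV, hS, rfl⟩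
  -- conjugate everything by `P₀`
  obtain ⟨e, he⟩ := exists_conjEquiv P₀
  let W : Submodule ℂ (Matrix (Fin b) (Fin b) ℂ) := V.map (e : Matrix (Fin b) (Fin b) ℂ →ₗ[ℂ] Matrix (Fin b) (Fin b) ℂ)
  let W₀ : Submodule ℂ (Matrix (Fin b) (Fin b) ℂ) := S₀.map (e : Matrix (Fin b) (Fin b) ℂ →ₗ[ℂ] Matrix (Fin b) (Fin b) ℂ)
  have hmemW : ∀ {X}, X ∈ W → ∃ A ∈ V, e A = X := fun hX => Submodule.mem_map.mp hX
  have hmemW₀ : ∀ {X}, X ∈ W₀ → ∃ A ∈ S₀, e A = X := fun hX => Submodule.mem_map.mp hX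
  have hWnil : ∀ X ∈ W, IsNilpotent X := by
    intro X hX
    obtain ⟨A, hA, rfl⟩ := hmemW hX
    obtain ⟨k, hk⟩ := hnil A hA
    exact ⟨k, by rw [he, Units.conj_pow, hk, Matrix.mul_zero, Matrix.zero_mul]⟩
  have hconj_mul : ∀ A B : Matrix (Fin b) (Fin b) ℂ, e A * e B = e (A * B) := by
    intro A B
    rw [he, he, he]
    have h1 : (P₀ : Matrix (Fin b) (Fin b) ℂ) * A * (↑P₀⁻¹ : Matrix (Fin b) (Fin b) ℂ) *
        ((P₀ : Matrix (Fin b) (Fin b) ℂ) * B * (↑P₀⁻¹ : Matrix (Fin b) (Fin b) ℂ))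
        = (P₀ : Matrix (Fin b) (Fin b) ℂ) * A * ((↑P₀⁻¹ : Matrix (Fin b) (Fin b) ℂ) * (P₀ : Matrix (Fin b) (Fin b) ℂ)) *
          B * (↑P₀⁻¹ : Matrix (Fin b) (Fin b) ℂ) := by
      simp only [Matrix.mul_assoc]
    rw [h1, Units.inv_mul, Matrix.mul_one]
    simp only [Matrix.mul_assoc]
  have hWwc : ∀ X ∈ W, ∀ X' ∈ W, ∃ γ : ℂ, X * X' + γ • (X' * X) ∈ W := by
    intro X hX X' hX'
    obtain ⟨A, hA, rfl⟩ := hmemW hX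
    obtain ⟨B, hB, rfl⟩ := hmemW hX'
    obtain ⟨γ, hγ⟩ := hwc A hA B hB
    refine ⟨γ, ?_⟩
    rw [hconj_mul, hconj_mul, ← map_smul, ← map_add]
    exact Submodule.mem_map_of_mem hγ
  have hW₀W : W₀ ≤ W := Submodule.map_mono hS₀V
  have hW₀su : ∀ X ∈ W₀, ∀ i j : Fin b, j ≤ i → X i j = 0 := by
    intro X hX i j hji
    obtain ⟨A, hA, rfl⟩ := hmemW₀ hX
    rw [he]; exact hP₀ A hA i j hji
  -- pulling a triangularisation back through the conjugation
  have hback : ∀ T : Submodule ℂ (Matrix (Fin b) (Fin b) ℂ), T ≤ W → Tri T →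
      Module.finrank ℂ T ≤ d₀ := by
    intro T hTW hT
    obtain ⟨P₁, hP₁⟩ := hT
    let T' : Submodule ℂ (Matrix (Fin b) (Fin b) ℂ) := T.map (e.symm : Matrix (Fin b) (Fin b) ℂ →ₗ[ℂ] Matrix (Fin b) (Fin b) ℂ)
    have hT'V : T' ≤ V := by
      intro A hA
      obtain ⟨X, hX, rfl⟩ := Submodule.mem_map.mp hA
      obtain ⟨A', hA', hA'X⟩ := hmemW (hTW hX)
      rw [← hA'X, LinearEquiv.coe_coe, LinearEquiv.symm_apply_apply]
      exact hA'
    have hT'tri : Tri T' := by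
      refine ⟨P₁ * P₀, fun A hA i j hji => ?_⟩
      obtain ⟨X, hX, rfl⟩ := Submodule.mem_map.mp hA
      have eX : (P₀ : Matrix (Fin b) (Fin b) ℂ) * (e.symm X) * (↑P₀⁻¹ : Matrix (Fin b) (Fin b) ℂ) = X := by
        rw [← he, LinearEquiv.apply_symm_apply]
      have key : ((P₁ * P₀ : (Matrix (Fin b) (Fin b) ℂ)ˣ) : Matrix (Fin b) (Fin b) ℂ) *
          ((e.symm : Matrix (Fin b) (Fin b) ℂ →ₗ[ℂ] Matrix (Fin b) (Fin b) ℂ) X) *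
          (↑(P₁ * P₀)⁻¹ : Matrix (Fin b) (Fin b) ℂ)
          = (P₁ : Matrix (Fin b) (Fin b) ℂ) * X * (↑P₁⁻¹ : Matrix (Fin b) (Fin b) ℂ) := by
        rw [_root_.mul_inv_rev, Units.val_mul, Units.val_mul, LinearEquiv.coe_coe]
        conv_rhs => rw [← eX]
        simp only [Matrix.mul_assoc]
      rw [key]
      exact hP₁ X hX i j hji
    have hfin : Module.finrank ℂ T' = Module.finrank ℂ T := LinearEquiv.finrank_map_eq e.symm T
    rw [← hfin]
    exact hmax T' hT'V hT'tri
  -- `W₀` contains every strictly upper member of `W` (maximality)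
  have hW₀max : ∀ X ∈ W, (∀ i j : Fin b, j ≤ i → X i j = 0) → X ∈ W₀ := by
    intro X hX hsu
    let T : Submodule ℂ (Matrix (Fin b) (Fin b) ℂ) := W₀ ⊔ (ℂ ∙ X)
    have hTW : T ≤ W := sup_le hW₀W ((Submodule.span_singleton_le_iff_mem X W).mpr hX)
    have hTtri : Tri T := by
      refine ⟨1, fun A hA i j hji => ?_⟩
      rw [Units.val_one, inv_one, Units.val_one, Matrix.one_mul, Matrix.mul_one]
      obtain ⟨u, hu, w, hw, rfl⟩ := Submodule.mem_sup.mp hA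
      obtain ⟨c, rfl⟩ := Submodule.mem_span_singleton.mp hw
      rw [Matrix.add_apply, Matrix.smul_apply, hW₀su u hu i j hji, hsu i j hji, smul_zero, add_zero]
    have hle : Module.finrank ℂ T ≤ Module.finrank ℂ W₀ := by
      rw [LinearEquiv.finrank_map_eq e S₀, hS₀d]; exact hback T hTW hTtri
    have heq : W₀ = T := Submodule.eq_of_le_of_finrank_le le_sup_left hle
    rw [heq]
    exact Submodule.mem_sup_right (Submodule.mem_span_singleton_self X)
  -- either `W` is strictly upper (done), or PUSH + CORE contradict maximality
  by_cases hall : ∀ X ∈ W, ∀ i j : Fin b, j ≤ i → X i j = 0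
  · refine ⟨P₀, fun A hA i j hji => ?_⟩
    rw [← he]
    exact hall (e A) (Submodule.mem_map_of_mem hA) i j hji
  · exfalso
    push Not at hall
    obtain ⟨X₁, hX₁, i₁, j₁, hji₁, hne₁⟩ := hall
    obtain ⟨Y, hYW, hYn, hYrel⟩ := exists_push W W₀ hWwc hW₀W hW₀su hW₀max
      ⟨X₁, hX₁, fun h => hne₁ (h i₁ j₁ hji₁)⟩
    obtain ⟨P₁, hP₁⟩ := exists_unit_conj_strictUpper_sup_span W₀ hW₀su Y (hWnil Y hYW) hYrel
    let T : Submodule ℂ (Matrix (Fin b) (Fin b) ℂ) := W₀ ⊔ (ℂ ∙ Y)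
    have hTW : T ≤ W := sup_le hW₀W ((Submodule.span_singleton_le_iff_mem Y W).mpr hYW)
    have hle : Module.finrank ℂ T ≤ d₀ := hback T hTW ⟨P₁, hP₁⟩
    have hYT : Y ∉ W₀ := fun h => hYn (hW₀su Y h)
    have hlt : W₀ < T := by
      refine lt_of_le_of_ne le_sup_left fun heq => hYT ?_
      rw [heq]; exact Submodule.mem_sup_right (Submodule.mem_span_singleton_self Y)
    have h1 := Submodule.finrank_lt_finrank_of_lt hlt
    rw [LinearEquiv.finrank_map_eq e S₀, hS₀d] at h1
    omega

/-- ★ **JORDAN-closed nil spaces** (`AB + BA ∈ V`) are simultaneously strictly upper triangularisable. [cite: Jacobson1962LieAlgebras, Ch. II §2 Thm. 1] -/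
theorem exists_unit_conj_strictUpper_of_jordanClosed (V : Submodule ℂ (Matrix (Fin b) (Fin b) ℂ))
    (hnil : ∀ A ∈ V, IsNilpotent A) (hjordan : ∀ A ∈ V, ∀ B ∈ V, A * B + B * A ∈ V) :
    ∃ P : (Matrix (Fin b) (Fin b) ℂ)ˣ, ∀ A ∈ V, ∀ i j : Fin b, j ≤ i →
      ((P : Matrix (Fin b) (Fin b) ℂ) * A * (↑P⁻¹ : Matrix (Fin b) (Fin b) ℂ)) i j = 0 :=
  exists_unit_conj_strictUpper_of_weaklyClosed V hnil fun A hA B hB => ⟨1, by rw [one_smul]; exact hjordan A hA B hB⟩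

/-- **`γ`-closed nil spaces** (one fixed scalar: `AB + γ·BA ∈ V`) are simultaneously strictly upper triangularisable. [folklore] -/
theorem exists_unit_conj_strictUpper_of_smulClosed (V : Submodule ℂ (Matrix (Fin b) (Fin b) ℂ))
    (hnil : ∀ A ∈ V, IsNilpotent A) (γ : ℂ) (hγ : ∀ A ∈ V, ∀ B ∈ V, A * B + γ • (B * A) ∈ V) :
    ∃ P : (Matrix (Fin b) (Fin b) ℂ)ˣ, ∀ A ∈ V, ∀ i j : Fin b, j ≤ i →
      ((P : Matrix (Fin b) (Fin b) ℂ) * A * (↑P⁻¹ : Matrix (Fin b) (Fin b) ℂ)) i j = 0 :=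
  exists_unit_conj_strictUpper_of_weaklyClosed V hnil fun A hA B hB => ⟨γ, hγ A hA B hB⟩

/-! ## §5 THE JACOBSON ROW of the (c)-menu -/

variable {n m : ℕ}

/-- ★★ **THE JACOBSON ROW.**  An affine pencil `N` all of whose values lie in a weakly closed linear space of nilpotent matrices has
`RelCert n m N (2·(⌊√n⌋·m))` — (c)'s conclusion with `c = 2`, `n₀ = 0`. [cite: Jacobson1962LieAlgebras, Ch. II §2 Thm. 1] -/
theorem relCert_of_valueSpace_weaklyClosed (N : AffMat n m) (hN : IsAffine N)
    (V : Submodule ℂ (Matrix (Fin m) (Fin m) ℂ)) (hV : ∀ x : Fin n × Fin n → ℂ, N.map (MvPolynomial.eval x) ∈ V)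
    (hnil : ∀ A ∈ V, IsNilpotent A) (hwc : ∀ A ∈ V, ∀ B ∈ V, ∃ γ : ℂ, A * B + γ • (B * A) ∈ V) :
    RelCert n m N (2 * (Nat.sqrt n * m)) := by
  obtain ⟨P, hP⟩ := exists_unit_conj_strictUpper_of_weaklyClosed V hnil hwc
  exact relCert_of_valueSpace_triangularisable_two N hN V hV P hP

/-- ★ **The Jordan row**: values in a Jordan-closed nil space ⇒ `RelCert n m N (2·(⌊√n⌋·m))`. [cite: Jacobson1962LieAlgebras, Ch. II §2 Thm. 1] -/
theorem relCert_of_valueSpace_jordanClosed (N : AffMat n m) (hN : IsAffine N)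
    (V : Submodule ℂ (Matrix (Fin m) (Fin m) ℂ)) (hV : ∀ x : Fin n × Fin n → ℂ, N.map (MvPolynomial.eval x) ∈ V)
    (hnil : ∀ A ∈ V, IsNilpotent A) (hjordan : ∀ A ∈ V, ∀ B ∈ V, A * B + B * A ∈ V) :
    RelCert n m N (2 * (Nat.sqrt n * m)) := by
  obtain ⟨P, hP⟩ := exists_unit_conj_strictUpper_of_jordanClosed V hnil hjordan
  exact relCert_of_valueSpace_triangularisable_two N hN V hV P hP

/-- ★ **(c) ON THE WEAKLY CLOSED LOCUS**, in the binder shape of the stub `SlowCore.LongMassSlowLawInv` with `c = 2`, `n₀ = 0`: the hypotheses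
`B ^ b = 0` / `IrreducibleInv B` replaced by «the values of `B` lie in a weakly closed space of nilpotent matrices» (NOT an instance of the
stub: an irreducible constituent of size `b ≥ 2` is never triangularisable).  Contrapositive = violator portrait: the value space of a
(c)-violator admits `A, B` with `AB + γ·BA ∉ V` for EVERY `γ`. [cite: Jacobson1962LieAlgebras, Ch. II §2 Thm. 1] -/
theorem longMass_on_weaklyClosed_locus :
    ∀ n b : ℕ, ∀ B : AffMat n b, IsAffine B →
      (∃ V : Submodule ℂ (Matrix (Fin b) (Fin b) ℂ), (∀ x : Fin n × Fin n → ℂ, B.map (MvPolynomial.eval x) ∈ V) ∧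
        (∀ A ∈ V, IsNilpotent A) ∧ (∀ A ∈ V, ∀ A' ∈ V, ∃ γ : ℂ, A * A' + γ • (A' * A) ∈ V)) →
      RelCert n b B (2 * (Nat.sqrt n * b)) := by
  intro n b B hB hV
  obtain ⟨V, hV, hnil, hwc⟩ := hV
  exact relCert_of_valueSpace_weaklyClosed B hB V hV hnil hwc

end Summit.ValiantsHypothesis.ValiantsHypothesis.Theorems.GrenetZeon.NilSpaceJacobson

end
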